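import Mathlib
import Literature.Analysis.FluidPDE.Tao2016AveragedNS.ShiftSetCascadeFlux
import Summits.NavierStokesRegularity.NavierStokesRegularity.Theorems.TaoLadderRungThreeGappedFrontRobustTailEnergy
import HarnessLib

/-!
# Shift-set pseudo-flows `PseudoFlowOnShift 𝕊`: the bond flux against the TAIL ENERGY and the tail
  energy cap on a nearest-neighbour slot-closed shift set (helper for item
  stmt-NavierStokesRegularity-22988 `GappedFrontRobustV2Flat`, crux K_B♭ of route TaoLadderRungTwoFlat)

The `𝕊`-parametrised version of `Theorems/TaoLadderRungThreeGappedFrontRobustTailEnergy.lean` (p1 g9, on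
Tao's one-way `S`). WHY THE ONE-DIRECTIONAL TAIL BOOKKEEPING SURVIVES BACKSCATTER. On a nearest-neighbour
shift set every triad based at shell `n` lives on the shells `n, n+1`, so under the cancellation (4.3)
the energy of the half-line of shells `k ≥ K` changes ONLY through the bond flux `B_𝕊(K-1)` of the
triads based at `K-1` (`PseudoFlowOnShift.block_energy_le`, tree). On `S` that flux is quadratic in
the shell `K-1` below the bond; on the two-way `S♭` it also contains the backscatter classes
`(1,0,1), (0,1,1)` — ONE factor on the shell `K-1`, TWO on the shell `K` — but never two factors above
the bond and one two shells up: the shells `k ≥ K+1` do not enter. Hence, with `|S_{i,K-1}| ≤ P` and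
`y = ∑ᵢ F_{i,K} ≤` (tail energy above the bond),
`|B_𝕊(K-1)| ≤ (1+ε₀)^{5(K-1)/2} (∑_{bot}|α|) (P² √(2y) + 2 P y)` (`abs_botSumOn_le_tail`): the
integral inequality for the tail energy is of Bihari–Grönwall type `y ≤ E₀ + ∫ (a√y + b y)` with the
exponential rate `b = 2 (1+ε₀)^{5(K-1)/2} (∑|α|) P` SMALL far ahead of the front (`P ≍ r/w(K-2)`
decays super-geometrically under the tail clause (T1)). So the tail induction of K_B₂ goes through on
`S♭` shell by shell, with an extra factor `exp(b τ /2) ≤ 2`; no simultaneous bootstrap over the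
infinitely many tail shells and no truncation limit are needed (this corrects the cell note
`rung3/p1g11/KBflat-tail-note-p1g11.md`, which read the flux against the single-shell energy).

This file: `abs_botSumOn_le_tail` (the flux bound above; hypothesis `(1,1,1) ∉ 𝕊`, true for `S`, `S♭`),
`pseudoFlowOnShift_botSumOn_tail_small` ((4.5) ⇒ the top flux `B_𝕊(N)` is uniformly small as
`N → ∞`), the TAIL ENERGY CAP `pseudoFlowOnShift_tail_energy_le` (all partial sums of the energies
over `k ≥ K` are `≤ E₀ + ∫ B_𝕊(K-1)`) with its per-shell / amplitude forms
`pseudoFlowOnShift_shell_energy_le_tail`, `pseudoFlowOnShift_sq_le_tail`.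

HONEST FRAMING: elementary real-analysis lemmas about Tao-type MODEL lattice pseudo-flows (Tao 2016 §4
(4.5), (4.9)–(4.10) with (4.3)) on a general shift set; nothing here is a statement about the
Navier–Stokes equations, and nothing is asserted about any table (p1 g12).
-/

noncomputable section

-- the sub-problem namespace `Summit.NavierStokesRegularity.NavierStokesRegularity` repeats the summit name by design (D-0017)
set_option linter.dupNamespace false

namespace Summit.NavierStokesRegularity.NavierStokesRegularity.Theorems

open Set MeasureTheory intervalIntegral Literature.Analysis.FluidPDE Literature.Analysis.FluidPDE.TaoCascade

namespace GappedFrontRobustOn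

variable {m : ℕ} {𝕊 : Finset (ℤ × ℤ × ℤ)}

/-! ### The bond flux against the energy ABOVE the bond -/

/-- **Bond flux against the tail energy** (nearest-neighbour `𝕊` not containing the spurious class
`(1,1,1)`, `1+ε₀ > 0`): if `|X_{i,n}(t)| ≤ P` (`P ≥ 0`) on the shell below the bond `n | n+1` and the
shell above it has nonnegative energies with `½ X_{i,n+1}(t)² ≤ E_{i,n+1}(t)`, then with
`y := ∑ᵢ E_{i,n+1}(t)`,
`|B_𝕊(n)(t)| ≤ (1+ε₀)^{5n/2} (∑_{botShifts 𝕊}|α|) (P² √(2y) + 2 P y)` — every bond-crossing class has its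
output and at most one input above the bond. [cite: Tao2016AveragedNS, §4 proof of Lemma 4.1 (v) (the boundary terms) and p. 9 footnote 7] -/
theorem abs_botSumOn_le_tail (h𝕊 : IsNearestNeighbourSet 𝕊)
    (h111 : ((1 : ℤ), (1 : ℤ), (1 : ℤ)) ∉ 𝕊) (ε₀ : ℝ) (hε : 0 < 1 + ε₀)
    (α : Fin m → Fin m → Fin m → ℤ × ℤ × ℤ → ℝ) (X E : Fin m → ℤ → ℝ → ℝ) (n : ℤ) (t : ℝ)
    {P : ℝ} (hP0 : 0 ≤ P) (hP : ∀ i, |X i n t| ≤ P)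
    (hE : ∀ i, 0 ≤ E i (n + 1) t) (hXE : ∀ i, (1 / 2) * X i (n + 1) t ^ 2 ≤ E i (n + 1) t) :
    |botSumOn 𝕊 ε₀ α X n t| ≤ (1 + ε₀) ^ ((5 : ℝ) * n / 2) * coeffAbsOn (botShifts 𝕊) α *
      (P ^ 2 * Real.sqrt (2 * ∑ i, E i (n + 1) t) + 2 * P * ∑ i, E i (n + 1) t) := by
  set y : ℝ := ∑ i, E i (n + 1) t with hy
  have hy0 : 0 ≤ y := Finset.sum_nonneg fun i _ => hE i
  set Q : ℝ := Real.sqrt (2 * y) with hQ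
  have hQ0 : 0 ≤ Q := Real.sqrt_nonneg _
  have hQQ : Q * Q = 2 * y := Real.mul_self_sqrt (by positivity)
  -- amplitudes of the upper shell through its energy
  have hXQ : ∀ i, |X i (n + 1) t| ≤ Q := by
    intro i
    have h1 : E i (n + 1) t ≤ y :=
      Finset.single_le_sum (f := fun j => E j (n + 1) t) (fun j _ => hE j) (Finset.mem_univ i)
    exact Real.abs_le_sqrt (by linarith [hXE i])
  -- slot bounds: `P` on the shell `n`, `Q` on every other shell
  set B : ℤ → ℝ := fun k => if k = n then P else Q with hB
  have hB0 : ∀ k, 0 ≤ B k := fun k => by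
    simp only [hB]; split_ifs <;> assumption
  have hBn : B n = P := by simp [hB]
  have hBn1 : B (n + 1) = Q := by simp [hB]
  have hslot : ∀ j : ℤ, (j = 0 ∨ j = 1) → ∀ i, |X i (n + j) t| ≤ B (n + j) := by
    rintro j (rfl | rfl) i
    · simpa [hBn] using hP i
    · rw [hBn1]; exact hXQ i
  have h := abs_fullSumOn_le_of_slot_bounds (𝕋 := botShifts 𝕊) ε₀ hε α X n t hB0
    (fun μ hμ i => by
      have hμ𝕊 : μ ∈ 𝕊 := (Finset.mem_filter.mp hμ).1
      exact ⟨hslot _ (h𝕊 μ hμ𝕊).1 i, hslot _ (h𝕊 μ hμ𝕊).2.1 i, hslot _ (h𝕊 μ hμ𝕊).2.2 i⟩)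
  -- every admissible slot product is at most `P² Q + P Q²`
  set G : ℝ := P ^ 2 * Q + 2 * P * y with hG
  have hG0 : 0 ≤ G := by positivity
  have hprod : ∀ μ ∈ botShifts 𝕊, B (n + μ.1) * B (n + μ.2.1) * B (n + μ.2.2) ≤ G := by
    intro μ hμ
    obtain ⟨hμ𝕊, hμ3⟩ := Finset.mem_filter.mp hμ
    obtain ⟨h1, h2, -⟩ := h𝕊 μ hμ𝕊
    have hne : ¬ (μ.1 = 1 ∧ μ.2.1 = 1) := by
      rintro ⟨ha, hb⟩
      apply h111
      have : μ = ((1 : ℤ), (1 : ℤ), (1 : ℤ)) := Prod.ext ha (Prod.ext hb hμ3)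
      rwa [this] at hμ𝕊
    rw [hμ3, hBn1]
    have hPQ2 : P * Q * Q = 2 * P * y := by rw [mul_assoc, hQQ]; ring
    rcases h1 with ha | ha <;> rcases h2 with hb | hb
    · rw [ha, hb, add_zero, hBn]
      nlinarith [mul_nonneg hP0 hy0]
    · rw [ha, hb, add_zero, hBn, hBn1]
      nlinarith [mul_nonneg (sq_nonneg P) hQ0]
    · rw [ha, hb, add_zero, hBn, hBn1]
      nlinarith [mul_nonneg (sq_nonneg P) hQ0]
    · exact absurd ⟨ha, hb⟩ hne
  have hsum : ∑ i₁, ∑ i₂, ∑ i₃, ∑ μ ∈ botShifts 𝕊,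
      |α i₁ i₂ i₃ μ| * (B (n + μ.1) * B (n + μ.2.1) * B (n + μ.2.2)) ≤
      coeffAbsOn (botShifts 𝕊) α * G := by
    simp only [coeffAbsOn, Finset.sum_mul]
    refine Finset.sum_le_sum fun i₁ _ => Finset.sum_le_sum fun i₂ _ =>
      Finset.sum_le_sum fun i₃ _ => Finset.sum_le_sum fun μ hμ => ?_
    exact mul_le_mul_of_nonneg_left (hprod μ hμ) (abs_nonneg _)
  have hΛ : 0 ≤ (1 + ε₀) ^ ((5 : ℝ) * n / 2) := (Real.rpow_pos_of_pos hε _).le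
  calc |botSumOn 𝕊 ε₀ α X n t|
      ≤ (1 + ε₀) ^ ((5 : ℝ) * n / 2) * ∑ i₁, ∑ i₂, ∑ i₃, ∑ μ ∈ botShifts 𝕊,
          |α i₁ i₂ i₃ μ| * (B (n + μ.1) * B (n + μ.2.1) * B (n + μ.2.2)) := h
    _ ≤ (1 + ε₀) ^ ((5 : ℝ) * n / 2) * (coeffAbsOn (botShifts 𝕊) α * G) :=
        mul_le_mul_of_nonneg_left hsum hΛ
    _ = (1 + ε₀) ^ ((5 : ℝ) * n / 2) * coeffAbsOn (botShifts 𝕊) α *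
          (P ^ 2 * Real.sqrt (2 * ∑ i, E i (n + 1) t) + 2 * P * ∑ i, E i (n + 1) t) := by
        simp only [hG, hQ, hy]; ring

variable {τ ε₀ : ℝ} {α : Fin m → Fin m → Fin m → ℤ × ℤ × ℤ → ℝ} {κ₁ κ₂ : ℝ}
  {S₀ F₀ B₀ : Fin m → ℤ → ℝ} {S F : Fin m → ℤ → ℝ → ℝ}

/-! ### The vanishing of the top bond flux -/

/-- **The top bond flux of a pseudo-flow on `𝕊` vanishes uniformly** (nearest-neighbour `𝕊`,
`ε₀ > 0`): by the a priori regularity (4.5), for every `δ > 0` there is `N₀` with `|B_𝕊(N)(u)| ≤ δ`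
for all `N ≥ N₀` and `u ∈ [0, τ]`. [cite: Tao2016AveragedNS, §4 Lemma 4.1 (4.5)] -/
theorem pseudoFlowOnShift_botSumOn_tail_small (h𝕊 : IsNearestNeighbourSet 𝕊)
    (h : PseudoFlowOnShift 𝕊 τ ε₀ α κ₁ κ₂ S₀ F₀ B₀ S F) (hε : 0 < ε₀) {δ : ℝ} (hδ : 0 < δ) :
    ∃ N₀ : ℤ, ∀ N : ℤ, N₀ ≤ N → ∀ u ∈ Icc 0 τ, |botSumOn 𝕊 ε₀ α S N u| ≤ δ := by
  have hq : 0 < 1 + ε₀ := by linarith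
  have hq1 : 1 ≤ 1 + ε₀ := by linarith
  obtain ⟨M, hM⟩ := h.apriori_S
  set M' : ℝ := max M 0 with hM'
  have hM'0 : 0 ≤ M' := le_max_right _ _
  have hX : ∀ u ∈ Icc 0 τ, ∀ (i : Fin m) (k : ℤ),
      (1 + (1 + ε₀) ^ ((10 : ℝ) * k)) * |S i k u| ≤ M' :=
    fun u hu i k => (hM u hu i k).trans (le_max_left _ _)
  set C : ℝ := coeffAbsOn (botShifts 𝕊) α with hCdef
  have hC : 0 ≤ C := coeffAbsOn_nonneg _ _
  have hbinv : (1 + ε₀)⁻¹ < 1 := inv_lt_one_of_one_lt₀ (by linarith)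
  have hbinv0 : 0 < (1 + ε₀)⁻¹ := inv_pos.mpr hq
  have hden : 0 < M' ^ 3 * C + 1 := by positivity
  obtain ⟨n, hn⟩ := exists_pow_lt_of_lt_one (div_pos hδ hden) hbinv
  refine ⟨n, fun N hN u hu => ?_⟩
  have hN0 : (0 : ℤ) ≤ N := le_trans (by exact_mod_cast Nat.zero_le n) hN
  have hN0' : (0 : ℝ) ≤ N := by exact_mod_cast hN0
  -- both shells `N`, `N+1` are bounded by `P := M' (1+ε₀)^{-10N}`
  set P : ℝ := M' * (1 + ε₀) ^ (-(10 : ℝ) * N) with hP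
  have hP0 : 0 ≤ P := mul_nonneg hM'0 (Real.rpow_pos_of_pos hq _).le
  have hPN : ∀ i, |S i N u| ≤ P ∧ |S i (N + 1) u| ≤ P := by
    intro i
    refine ⟨(GappedFrontRobust.abs_le_of_weight hq (hX u hu i N)).1, ?_⟩
    have h1 := (GappedFrontRobust.abs_le_of_weight hq (hX u hu i (N + 1))).1
    refine h1.trans (mul_le_mul_of_nonneg_left ?_ hM'0)
    push_cast
    exact Real.rpow_le_rpow_of_exponent_le hq1 (by nlinarith)
  have hb := abs_botSumOn_le_of_abs_le h𝕊 ε₀ hq α S N u hP0 hPN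
  -- the powers: (1+ε₀)^{5N/2} P³ = M'³ (1+ε₀)^{5N/2 - 30N} ≤ M'³ (1+ε₀)^{-N}
  have hpow : (1 + ε₀) ^ ((5 : ℝ) * N / 2) * P ^ 3 ≤ (1 + ε₀) ^ (-(N : ℝ)) * M' ^ 3 := by
    have hq3 : (1 + ε₀) ^ (3 * (-(10 : ℝ) * N)) = ((1 + ε₀) ^ (-(10 : ℝ) * N)) ^ 3 := by
      rw [show (3 : ℝ) * (-(10 : ℝ) * N) = (-(10 : ℝ) * N) * ((3 : ℕ) : ℝ) by push_cast; ring]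
      exact Real.rpow_mul_natCast hq.le _ 3
    have h3 : (1 + ε₀) ^ ((5 : ℝ) * N / 2) * P ^ 3 =
        M' ^ 3 * (1 + ε₀) ^ ((5 : ℝ) * N / 2 + 3 * (-(10 : ℝ) * N)) := by
      rw [Real.rpow_add hq, hq3, hP]
      ring
    rw [h3, mul_comm ((1 + ε₀) ^ (-(N : ℝ)))]
    refine mul_le_mul_of_nonneg_left ?_ (pow_nonneg hM'0 3)
    exact Real.rpow_le_rpow_of_exponent_le hq1 (by nlinarith)
  have h2 : (1 + ε₀) ^ (-(N : ℝ)) ≤ ((1 + ε₀)⁻¹) ^ n := by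
    have : (1 + ε₀) ^ (-(N : ℝ)) ≤ (1 + ε₀) ^ (-(n : ℝ)) :=
      Real.rpow_le_rpow_of_exponent_le hq1 (by
        have : (n : ℝ) ≤ (N : ℝ) := by exact_mod_cast hN
        linarith)
    refine this.trans (le_of_eq ?_)
    rw [Real.rpow_neg hq.le, Real.rpow_natCast, inv_pow]
  calc |botSumOn 𝕊 ε₀ α S N u| ≤ (1 + ε₀) ^ ((5 : ℝ) * N / 2) * P ^ 3 * C := hb
    _ ≤ (1 + ε₀) ^ (-(N : ℝ)) * M' ^ 3 * C := mul_le_mul_of_nonneg_right hpow hC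
    _ ≤ ((1 + ε₀)⁻¹) ^ n * M' ^ 3 * C := by gcongr
    _ ≤ δ / (M' ^ 3 * C + 1) * (M' ^ 3 * C) := by
        rw [mul_assoc]
        exact mul_le_mul_of_nonneg_right hn.le (by positivity)
    _ ≤ δ := by
        rw [div_mul_eq_mul_div, div_le_iff₀ hden]
        nlinarith

/-! ### The tail energy cap -/

/-- **TAIL ENERGY CAP on `𝕊`.** Along every pseudo-flow on `[0, τ]` on a nearest-neighbour slot-closed
shift set (`τ > 0`, `ε₀ > 0`, cancelling table on `𝕊`), if all partial sums of the START energies over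
the shells `k ≥ K` are at most `E₀` (`∀ L, ∑_{k<L} ∑_i F₀_{i,K+k} ≤ E₀`), then for every `L` and every
`s ∈ [0, τ]`, `∑_{k<L} ∑_i F_{i,K+k}(s) ≤ E₀ + ∫₀^s B_𝕊(K-1)(u) du`: the energy above the bond `K-1 | K`
is fed only through that bond — on `S♭` as on `S`. [cite: Tao2016AveragedNS, §4 Lemma 4.1 (4.5), (4.9) with (4.3)] -/
theorem pseudoFlowOnShift_tail_energy_le (h𝕊 : IsNearestNeighbourSet 𝕊) (h𝕊c : IsSlotClosed 𝕊)
    (h : PseudoFlowOnShift 𝕊 τ ε₀ α κ₁ κ₂ S₀ F₀ B₀ S F) (hτ : 0 < τ)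
    (hε : 0 < ε₀) (hα : IsCancellingCoeffOn 𝕊 α) (K : ℤ) {E₀ : ℝ}
    (hE₀ : ∀ L : ℕ, ∑ k ∈ Finset.range L, ∑ i, F₀ i (K + k) ≤ E₀)
    (L : ℕ) {s : ℝ} (hs : s ∈ Icc 0 τ) :
    ∑ k ∈ Finset.range L, ∑ i, F i (K + k) s ≤
      E₀ + ∫ u in (0 : ℝ)..s, botSumOn 𝕊 ε₀ α S (K - 1) u := by
  have hS : ∀ i n, ContinuousOn (S i n) (Icc 0 τ) := fun i n => (h.contDiffOn_S i n).continuousOn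
  have hsub : uIcc 0 s ⊆ Icc 0 τ := by
    rw [uIcc_of_le hs.1]
    exact Icc_subset_Icc_right hs.2
  have hbint : ∀ n : ℤ, IntervalIntegrable (fun u => botSumOn 𝕊 ε₀ α S n u) volume 0 s := fun n =>
    ((continuousOn_botSumOn 𝕊 ε₀ α hS n).mono hsub).intervalIntegrable
  have hout : ∀ μ ∈ 𝕊, μ.2.2 = 0 ∨ μ.2.2 = 1 := fun μ hμ => (h𝕊 μ hμ).2.2
  refine le_of_forall_pos_le_add fun δ' hδ' => ?_
  -- top flux ≤ δ'/τ beyond N₀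
  obtain ⟨N₀, hN₀⟩ := pseudoFlowOnShift_botSumOn_tail_small h𝕊 h hε (div_pos hδ' hτ)
  -- a longer block whose top shell is beyond N₀
  set L' : ℕ := max L (N₀ - K + 1).toNat with hL'
  have hLL' : L ≤ L' := le_max_left _ _
  have htop : N₀ ≤ K + L' - 1 := by
    have h1 : (N₀ - K + 1 : ℤ) ≤ ((N₀ - K + 1).toNat : ℤ) := Int.self_le_toNat _
    have h2 : ((N₀ - K + 1).toNat : ℤ) ≤ (L' : ℤ) := by exact_mod_cast le_max_right _ _
    linarith
  have hmono : ∑ k ∈ Finset.range L, ∑ i, F i (K + k) s ≤ ∑ k ∈ Finset.range L', ∑ i, F i (K + k) s :=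
    Finset.sum_le_sum_of_subset_of_nonneg (Finset.range_mono hLL') fun k _ _ =>
      Finset.sum_nonneg fun i _ => h.nonneg_F i (K + k) s hs
  have hblock := h.block_energy_le hτ h𝕊c hout hα K L' hs
  have htopint : |∫ u in (0 : ℝ)..s, botSumOn 𝕊 ε₀ α S (K + L' - 1) u| ≤ δ' := by
    have hle : ∀ u ∈ Set.uIoc (0 : ℝ) s, ‖botSumOn 𝕊 ε₀ α S (K + L' - 1) u‖ ≤ δ' / τ := by
      intro u hu
      rw [uIoc_of_le hs.1] at hu
      exact hN₀ _ htop u ⟨hu.1.le, hu.2.trans hs.2⟩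
    have h1 := intervalIntegral.norm_integral_le_of_norm_le_const hle
    rw [Real.norm_eq_abs] at h1
    refine h1.trans ?_
    rw [sub_zero, abs_of_nonneg hs.1, div_mul_eq_mul_div, div_le_iff₀ hτ]
    exact mul_le_mul_of_nonneg_left hs.2 hδ'.le
  rw [intervalIntegral.integral_sub (hbint _) (hbint _)] at hblock
  have habs := neg_abs_le (∫ u in (0 : ℝ)..s, botSumOn 𝕊 ε₀ α S (K + L' - 1) u)
  linarith [hE₀ L']

/-- **Per-shell form of the tail energy cap on `𝕊`**: under the hypotheses of
`pseudoFlowOnShift_tail_energy_le`, every single shell `k ≥ K` satisfies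
`∑_i F_{i,k}(s) ≤ E₀ + ∫₀^s B_𝕊(K-1)`. [cite: Tao2016AveragedNS, §4 Lemma 4.1 (4.5), (4.9) with (4.3)] -/
theorem pseudoFlowOnShift_shell_energy_le_tail (h𝕊 : IsNearestNeighbourSet 𝕊) (h𝕊c : IsSlotClosed 𝕊)
    (h : PseudoFlowOnShift 𝕊 τ ε₀ α κ₁ κ₂ S₀ F₀ B₀ S F) (hτ : 0 < τ)
    (hε : 0 < ε₀) (hα : IsCancellingCoeffOn 𝕊 α) (K : ℤ) {E₀ : ℝ}
    (hE₀ : ∀ L : ℕ, ∑ k ∈ Finset.range L, ∑ i, F₀ i (K + k) ≤ E₀)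
    {k : ℤ} (hk : K ≤ k) {s : ℝ} (hs : s ∈ Icc 0 τ) :
    ∑ i, F i k s ≤ E₀ + ∫ u in (0 : ℝ)..s, botSumOn 𝕊 ε₀ α S (K - 1) u := by
  have hmem : (k - K).toNat ∈ Finset.range ((k - K).toNat + 1) := by simp
  have hk' : K + ((k - K).toNat : ℤ) = k := by
    rw [Int.toNat_of_nonneg (by linarith)]
    ring
  have h1 : ∑ i, F i k s ≤ ∑ j ∈ Finset.range ((k - K).toNat + 1), ∑ i, F i (K + j) s := by
    have := Finset.single_le_sum (f := fun j : ℕ => ∑ i, F i (K + j) s)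
      (fun j _ => Finset.sum_nonneg fun i _ => h.nonneg_F i (K + j) s hs) hmem
    simpa only [hk'] using this
  exact h1.trans (pseudoFlowOnShift_tail_energy_le h𝕊 h𝕊c h hτ hε hα K hE₀ _ hs)

/-- **Amplitude form of the tail energy cap on `𝕊`**: under the same hypotheses,
`½ S_{i,k}(s)² ≤ E₀ + ∫₀^s B_𝕊(K-1)` for every mode `i` and shell `k ≥ K` ((4.10), lower half).
[cite: Tao2016AveragedNS, §4 Lemma 4.1 (4.5), (4.9)–(4.10) with (4.3)] -/
theorem pseudoFlowOnShift_sq_le_tail (h𝕊 : IsNearestNeighbourSet 𝕊) (h𝕊c : IsSlotClosed 𝕊)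
    (h : PseudoFlowOnShift 𝕊 τ ε₀ α κ₁ κ₂ S₀ F₀ B₀ S F) (hτ : 0 < τ)
    (hε : 0 < ε₀) (hα : IsCancellingCoeffOn 𝕊 α) (K : ℤ) {E₀ : ℝ}
    (hE₀ : ∀ L : ℕ, ∑ k ∈ Finset.range L, ∑ i, F₀ i (K + k) ≤ E₀)
    (i : Fin m) {k : ℤ} (hk : K ≤ k) {s : ℝ} (hs : s ∈ Icc 0 τ) :
    (1 / 2) * S i k s ^ 2 ≤ E₀ + ∫ u in (0 : ℝ)..s, botSumOn 𝕊 ε₀ α S (K - 1) u := by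
  have h1 : F i k s ≤ ∑ j, F j k s :=
    Finset.single_le_sum (f := fun j => F j k s) (fun j _ => h.nonneg_F j k s hs) (Finset.mem_univ i)
  exact (h.defect_lower i k s hs).trans
    (h1.trans (pseudoFlowOnShift_shell_energy_le_tail h𝕊 h𝕊c h hτ hε hα K hE₀ hk hs))

end GappedFrontRobustOn

end Summit.NavierStokesRegularity.NavierStokesRegularity.Theorems

end
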